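import Summits.KontsevichZagierPeriods.KontsevichZagierPeriods.Theses.FurushoPentagon
import Summits.KontsevichZagierPeriods.KontsevichZagierPeriods.Theorems.HoffmanRelationInKZ.Negative.HoffmanElement
import Literature.NumberTheory.Transcendental.KZProductIdeal
import Literature.NumberTheory.Transcendental.KZUnfolding
import Literature.NumberTheory.Transcendental.MZVWordShuffle
import Literature.NumberTheory.Transcendental.SemialgebraicMapsProofs
import Summits.KontsevichZagierPeriods.KontsevichZagierPeriods.Theorems.FurushoPentagonHoffmanRelationInKZCubicalTransport
import Summits.KontsevichZagierPeriods.KontsevichZagierPeriods.Theorems.FurushoPentagonHoffmanRelationInKZShuffleCells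
import Summits.KontsevichZagierPeriods.KontsevichZagierPeriods.Theorems.FurushoPentagonHoffmanRelationInKZShuffleWords
import Summits.KontsevichZagierPeriods.KontsevichZagierPeriods.Theorems.FurushoPentagonHoffmanRelationInKZStuffleDissection
import Summits.KontsevichZagierPeriods.KontsevichZagierPeriods.Theorems.FurushoPentagonHoffmanRelationInKZDilationCalculus
import Summits.KontsevichZagierPeriods.KontsevichZagierPeriods.Theorems.FurushoPentagonHoffmanRelationInKZPeakExists
import Summits.KontsevichZagierPeriods.KontsevichZagierPeriods.Theorems.FurushoPentagonHoffmanRelationInKZDescents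

/-!
# `HoffmanRelationInKZ` (stmt-KontsevichZagierPeriods-3930, route FurushoPentagon) — line `dilation-homotopy-transposition`

PROOF of the crux along the picked line (lead prover-line-stmt-KontsevichZagierPeriods-3930-0; merges idea cards
`dilation-homotopy-transposition` ≈ `collar-blowup-uphill-stokes`, triage r1-1/2/3).  The crux: for every
admissible `s` and every `Z` pinned to the simplex classes, Hoffman's element
`H_Z(s) = Σ_i Z(s + e_i) − Σ_i Σ_{j ≤ s_i−2} Z(…, s_i − j, j + 1, …)` lies in `KZ.relations`.

LINE.  Hoffman(s) = (stuffle side) − (shuffle side) of the `ζ(1)`-extended word with the common divergent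
word `ζ(1, s)` absent from both (IKZ 2006 Thm 2 (v), `m = 1`).  In CUBICAL coordinates `tᵢ = x₀⋯xᵢ` on
`(0,1)ⁿ`, `n = weight s`, with `f_s(x) = ∏_{l<k} T_{p_l}(x)/(1 − T_{p_{l+1}}(x))` (`T_m = x₀⋯x_{m-1}`,
`p_l = s₁+⋯+s_l`):
* SHUFFLE SIDE `A_s = [{u < x₀} ⊂ (0,1)ⁿ⁺¹, f_s(x)/(1−u)]` ≡ `Σ_{gaps g ≥ 1} Z(word with 1 inserted at g)`
  `= Σ splits + Σ_i Z(s₁..s_{i+1},1,…)` (`stub_cubicalTransport` (3)–(4) + `stub_shuffleCells` + `stub_shuffleWords`);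
* STUFFLE SIDE `B_s = [(0,1)ⁿ⁺¹, (f_s(x) − u f_s(ux₀,x'))/(1−u)]` ≡ `Σ_i Z(s + e_i) + Σ_i Z(s₁..s_{i+1},1,…)`
  (`stub_stuffleDissection` + `stub_cubicalTransport` (1)–(2));
* LEVER `A_s ≡ B_s`: the peak `[{u < λ} ⊂ (0,1)ⁿ⁺², K_s(λx₀,x')/(1−u)]`, `K_s = ∂_μ(μ f_s) = f_s·Σ_l 1/(1−T_{p_{l+1}}) ≥ 0`,
  exists (`stub_peakExists`, Tonelli), descends onto `B_s` by Newton–Leibniz along `λ ∈ [u,1]` and — after the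
  FREE transposition `x₀ ↔ λ` (`KZ.of_sub_of_reindex_mem_relations`; the kernel depends on `λx₀` only) — onto
  `A_s` along `λ ∈ [0,1]`, both with the rational primitive `λ f_s(λx₀,x')/(1−u)` (`stub_descents`, fed by
  `stub_dilationCalculus`).
Subtracting, the insertion words cancel and `Σ_i Z(s+e_i) − Σ splits ∈ KZ.relations`.  `s = []` is trivial.

No definitions are introduced (D-0016): `f_s`, `K_s` and the shear `σ c x = (c x₀, x₁, …)` enter every stub as
functions with a DEFINING HYPOTHESIS, and the representations `A_s, A'_s, B_s, P_s, P'_s` as arbitrary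
`KZ.IntegralRep`s of prescribed domain and (on the domain) integrand — exactly as `Z` enters the crux.

References: Hoffman 1992 Thm 5.1; Ihara–Kaneko–Zagier 2006 Thm 2; Kontsevich–Zagier 2001 §1.2;
`Cruxes/HoffmanRelationInKZ/Ideas/dilation-homotopy-transposition.md`, `…/SketchDilationHomotopy.lean`,
`…/Disproof.lean` (gen 2: additivity AND Newton–Leibniz are both necessary at `s = (3)`; a NL-free proof
would be dimension-local — this chain adds the variable `λ`).
-/

noncomputable section

open Set MeasureTheory
open Literature.NumberTheory.Transcendental
open Summit.KontsevichZagierPeriods.KontsevichZagierPeriods.Theses.FurushoPentagon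

namespace Summit.KontsevichZagierPeriods.FurushoPentagon.HoffmanRelationInKZ

/-! The seven stubs of the line are LANDED helper files (`--supports stmt-KontsevichZagierPeriods-3930`) in this
namespace, imported above: `stub_cubicalTransport` (…CubicalTransport.lean + Aux, Aux2), `stub_shuffleCells`
(…ShuffleCells.lean), `stub_shuffleWords` (…ShuffleWords.lean), `stub_stuffleDissection` (…StuffleDissection.lean + Aux),
`stub_dilationCalculus` (…DilationCalculus.lean), `stub_peakExists` (…PeakExists.lean), `stub_descents` (…Descents.lean). -/

/-! ## Composition: the stubs imply the crux -/

open Summit.KontsevichZagierPeriods.HoffmanRelationInKZ.Negative (hoffmanElement Pinned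
  hoffmanRelationInKZ_iff hoffmanElement_eq raise split isAdmissible_raise list_sum_range_map_finset)

/-- Admissible non-empty indices have weight `≥ 2`. [folklore] -/
theorem two_le_weight {s : List ℕ} (hs : MZV.IsAdmissible s) (hne : s ≠ []) : 2 ≤ MZV.weight s := by
  obtain ⟨a, t, rfl⟩ := List.exists_cons_of_ne_nil hne
  have ha : 2 ≤ a := hs.2 (List.cons_ne_nil a t)
  simp only [MZV.weight, List.sum_cons]
  omega

/-- `insertOne s i` is admissible and non-empty for admissible non-empty `s`. [folklore] -/
theorem isAdmissible_insertOne {s : List ℕ} (hs : MZV.IsAdmissible s) (hne : s ≠ []) (i : ℕ) :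
    MZV.IsAdmissible (s.take (i + 1) ++ [1] ++ s.drop (i + 1)) ∧ s.take (i + 1) ++ [1] ++ s.drop (i + 1) ≠ [] := by
  obtain ⟨a, t, rfl⟩ := List.exists_cons_of_ne_nil hne
  refine ⟨⟨?_, ?_⟩, by simp⟩
  · intro x hx
    rcases List.mem_append.mp hx with hx | hx
    · rcases List.mem_append.mp hx with hx | hx
      · exact hs.1 x (List.mem_of_mem_take hx)
      · rw [List.mem_singleton] at hx
        rw [hx]
    · exact hs.1 x (List.mem_of_mem_drop hx)
  · intro h
    simp only [List.take_succ_cons, List.cons_append, List.head_cons]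
    exact hs.2 (List.cons_ne_nil _ _)

/-- The raised index is non-empty. [folklore] -/
theorem raise_ne_nil (s : List ℕ) (i : ℕ) : s.take i ++ [s.getD i 0 + 1] ++ s.drop (i + 1) ≠ [] := by
  simp

/-- A finite list sum of relations is a relation. [folklore] -/
theorem list_sum_mem_relations {ι : Type*} (l : List ι) (F : ι → KZ.FormalRep)
    (h : ∀ i ∈ l, F i ∈ KZ.relations) : (l.map F).sum ∈ KZ.relations := by
  induction l with
  | nil => simp [KZ.relations.zero_mem]
  | cons a l ih =>
    rw [List.map_cons, List.sum_cons]
    exact KZ.relations.add_mem (h a (by simp)) (ih fun i hi => h i (by simp [hi]))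

/-- `Σ (F + G) = Σ F + Σ G` over a list. [folklore] -/
theorem list_sum_map_add {ι : Type*} (l : List ι) (F G : ι → KZ.FormalRep) :
    (l.map fun i => F i + G i).sum = (l.map F).sum + (l.map G).sum := by
  induction l with
  | nil => simp
  | cons a l ih => simp [ih]; abel

/-- The transposition `x₀ ↔ λ` of `ℝⁿ⁺²` (coordinates `1` and `last`). -/
theorem swap_facts {n : ℕ} (hn : 2 ≤ n) :
    (Equiv.swap (1 : Fin (n + 2)) (Fin.last (n + 1))) 0 = 0 ∧
    (Equiv.swap (1 : Fin (n + 2)) (Fin.last (n + 1))) 1 = Fin.last (n + 1) ∧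
    (Equiv.swap (1 : Fin (n + 2)) (Fin.last (n + 1))) (Fin.last (n + 1)) = 1 ∧
    (∀ j : Fin (n + 2), j ≠ 1 → j ≠ Fin.last (n + 1) → (Equiv.swap (1 : Fin (n + 2)) (Fin.last (n + 1))) j = j) := by
  have h1 : (1 : Fin (n + 2)) ≠ Fin.last (n + 1) := by
    intro h; have := congrArg Fin.val h; simp [Fin.val_last] at this; omega
  have h0 : (0 : Fin (n + 2)) ≠ 1 := by simp
  have h0' : (0 : Fin (n + 2)) ≠ Fin.last (n + 1) := by
    intro h; have := congrArg Fin.val h; simp [Fin.val_last] at this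
  refine ⟨Equiv.swap_apply_of_ne_of_ne h0 h0', Equiv.swap_apply_left _ _, Equiv.swap_apply_right _ _,
    fun j hj hj' => Equiv.swap_apply_of_ne_of_ne hj hj'⟩

/-- **Hoffman's relation lies in the KZ calculus** (crux `HoffmanRelationInKZ` of route FurushoPentagon,
stmt-KontsevichZagierPeriods-3930): for every assignment `Z` pinned to the simplex classes and every admissible `s`,
`Σ_i Z(s + e_i) − Σ_i Σ_{j ≤ s_i − 2} Z(…, s_i − j, j + 1, …) ∈ KZ.relations` — an explicit move chain in cubical
coordinates: two dissections, two Newton–Leibniz moves along an unfolded dilation variable, one transposition.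
[cite: Hoffman1992, Thm 5.1] -/
theorem hoffmanRelationInKZ_proof :
    Summit.KontsevichZagierPeriods.KontsevichZagierPeriods.Theses.FurushoPentagon.HoffmanRelationInKZ := by
  rw [hoffmanRelationInKZ_iff]
  intro Z hZ s hs
  -- `s = []` : the element is `0`
  rcases eq_or_ne s [] with rfl | hne
  · simp [hoffmanElement, KZ.relations.zero_mem]
  -- the objects, by defining hypotheses
  set f : (Fin (MZV.weight s) → ℝ) → ℝ := fun x => ∏ l : Fin s.length, (∏ j : Fin (MZV.weight s), if (j : ℕ) < (s.take l).sum then x j else 1) / (1 - (∏ j : Fin (MZV.weight s), if (j : ℕ) < (s.take ((l : ℕ) + 1)).sum then x j else 1)) with hf_def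
  have hf : ∀ x, f x = ∏ l : Fin s.length, (∏ j : Fin (MZV.weight s), if (j : ℕ) < (s.take l).sum then x j else 1) / (1 - (∏ j : Fin (MZV.weight s), if (j : ℕ) < (s.take ((l : ℕ) + 1)).sum then x j else 1)) := fun x => rfl
  set K : (Fin (MZV.weight s) → ℝ) → ℝ := fun x => f x * ∑ l : Fin s.length, 1 / (1 - (∏ j : Fin (MZV.weight s), if (j : ℕ) < (s.take ((l : ℕ) + 1)).sum then x j else 1)) with hK_def
  have hK : ∀ x, K x = f x * ∑ l : Fin s.length, 1 / (1 - (∏ j : Fin (MZV.weight s), if (j : ℕ) < (s.take ((l : ℕ) + 1)).sum then x j else 1)) := fun x => rfl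
  set σ : ℝ → (Fin (MZV.weight s) → ℝ) → (Fin (MZV.weight s) → ℝ) :=
    fun c x j => if (j : ℕ) = 0 then c * x j else x j with hσ_def
  have hσ : ∀ (c : ℝ) (x : Fin (MZV.weight s) → ℝ) (j : Fin (MZV.weight s)),
      σ c x j = if (j : ℕ) = 0 then c * x j else x j := fun c x j => rfl
  have hn : 2 ≤ MZV.weight s := two_le_weight hs hne
  -- the cubically pinned assignment `C`, from stub (1)
  classical
  let C : List ℕ → KZ.FormalRep := fun u =>
    if h : MZV.IsAdmissible u ∧ u ≠ [] then
      KZ.of (Classical.choose (stub_cubicalTransport u h.1 h.2 (fun x => ∏ l : Fin u.length, (∏ j : Fin (MZV.weight u), if (j : ℕ) < (u.take l).sum then x j else 1) / (1 - (∏ j : Fin (MZV.weight u), if (j : ℕ) < (u.take ((l : ℕ) + 1)).sum then x j else 1))) (fun x => rfl)).1)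
    else 0
  have hC : (∀ (u : List ℕ), MZV.IsAdmissible u → u ≠ [] → ∃ r : KZ.IntegralRep (MZV.weight u), r.domain = {x : Fin (MZV.weight u) → ℝ | ∀ i, x i ∈ Set.Ioo (0:ℝ) 1} ∧ Set.EqOn r.integrand (fun x => ∏ l : Fin u.length, (∏ j : Fin (MZV.weight u), if (j : ℕ) < (u.take l).sum then x j else 1) / (1 - (∏ j : Fin (MZV.weight u), if (j : ℕ) < (u.take ((l : ℕ) + 1)).sum then x j else 1))) r.domain ∧ C u = KZ.of r) := by
    intro u hu hune
    refine ⟨Classical.choose (stub_cubicalTransport u hu hune (fun x => ∏ l : Fin u.length, (∏ j : Fin (MZV.weight u), if (j : ℕ) < (u.take l).sum then x j else 1) / (1 - (∏ j : Fin (MZV.weight u), if (j : ℕ) < (u.take ((l : ℕ) + 1)).sum then x j else 1))) (fun x => rfl)).1,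
      (Classical.choose_spec (stub_cubicalTransport u hu hune (fun x => ∏ l : Fin u.length, (∏ j : Fin (MZV.weight u), if (j : ℕ) < (u.take l).sum then x j else 1) / (1 - (∏ j : Fin (MZV.weight u), if (j : ℕ) < (u.take ((l : ℕ) + 1)).sum then x j else 1))) (fun x => rfl)).1).1,
      (Classical.choose_spec (stub_cubicalTransport u hu hune (fun x => ∏ l : Fin u.length, (∏ j : Fin (MZV.weight u), if (j : ℕ) < (u.take l).sum then x j else 1) / (1 - (∏ j : Fin (MZV.weight u), if (j : ℕ) < (u.take ((l : ℕ) + 1)).sum then x j else 1))) (fun x => rfl)).1).2, ?_⟩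
    simp only [C, dif_pos (And.intro hu hune)]
  have hCZ : ∀ u : List ℕ, MZV.IsAdmissible u → u ≠ [] → C u - Z u ∈ KZ.relations := by
    intro u hu hune
    have hT := stub_cubicalTransport u hu hune (fun x => ∏ l : Fin u.length, (∏ j : Fin (MZV.weight u), if (j : ℕ) < (u.take l).sum then x j else 1) / (1 - (∏ j : Fin (MZV.weight u), if (j : ℕ) < (u.take ((l : ℕ) + 1)).sum then x j else 1))) (fun x => rfl)
    have hr := Classical.choose_spec hT.1
    have hEq := hT.2.1 _ hr
    rw [hZ u hu]
    simp only [C, dif_pos (And.intro hu hune)]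
    exact hEq
  -- the stuffle side `B`
  obtain ⟨⟨rB, hrB⟩, hBdis⟩ := stub_stuffleDissection s hs hne f σ hf hσ C hC
  have hB : KZ.of rB - _ ∈ KZ.relations := hBdis rB hrB
  -- the dilation calculus, the peak `P` and its transpose `P'`
  have hcalc := stub_dilationCalculus s hs hne f K σ hf hK hσ
  obtain ⟨P, hP⟩ := stub_peakExists s hs hne f K σ hσ hcalc ⟨rB, hrB⟩
  obtain ⟨hdescA, hdescB⟩ := stub_descents s hs hne f K σ hσ hcalc
  have hPB : KZ.of P - KZ.of rB ∈ KZ.relations := hdescB rB P hrB hP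
  let e : Fin (MZV.weight s + 2) ≃ Fin (MZV.weight s + 2) := Equiv.swap 1 (Fin.last (MZV.weight s + 1))
  obtain ⟨he0', he1', heL', heid'⟩ := swap_facts hn
  have he0 : e 0 = 0 := he0'
  have he1 : e 1 = Fin.last (MZV.weight s + 1) := he1'
  have heL : e (Fin.last (MZV.weight s + 1)) = 1 := heL'
  have heid : ∀ j : Fin (MZV.weight s + 2), j ≠ 1 → j ≠ Fin.last (MZV.weight s + 1) → e j = j := heid'
  let P' : KZ.IntegralRep (MZV.weight s + 2) := P.reindex e
  have hPP' : KZ.of P - KZ.of P' ∈ KZ.relations := KZ.of_sub_of_reindex_mem_relations P e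
  have hP'shape : (P'.domain = {z : Fin (MZV.weight s + 2) → ℝ | (∀ i, z i ∈ Set.Ioo (0:ℝ) 1) ∧ z 0 < z 1} ∧ Set.EqOn P'.integrand (fun z => K (σ (z (Fin.last (MZV.weight s + 1))) (Fin.tail (Fin.init z))) / (1 - z 0)) P'.domain) := by
    have hdomP := hP.1
    have hintP := hP.2
    -- coordinates of `w ∘ e`
    have htail : ∀ w : Fin (MZV.weight s + 2) → ℝ,
        σ (w 1) (Fin.tail (Fin.init fun i => w (e i))) = σ (w (Fin.last (MZV.weight s + 1))) (Fin.tail (Fin.init w)) := by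
      intro w
      funext j
      simp only [hσ, Fin.tail, Fin.init]
      by_cases hj : (j : ℕ) = 0
      · rw [if_pos hj, if_pos hj]
        have hj1 : (Fin.castSucc j.succ : Fin (MZV.weight s + 2)) = 1 := by
          ext; simp [Fin.val_succ, hj]
        rw [hj1, he1, mul_comm]
      · rw [if_neg hj, if_neg hj]
        have hne1 : (Fin.castSucc j.succ : Fin (MZV.weight s + 2)) ≠ 1 := by
          intro h; have := congrArg Fin.val h; simp [Fin.val_succ] at this; omega
        have hneL : (Fin.castSucc j.succ : Fin (MZV.weight s + 2)) ≠ Fin.last (MZV.weight s + 1) := by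
          intro h; have := congrArg Fin.val h; simp [Fin.val_succ, Fin.val_last] at this; omega
        rw [heid _ hne1 hneL]
    constructor
    · ext w
      simp only [P', KZ.IntegralRep.reindex_domain, hdomP, Set.mem_setOf_eq]
      constructor
      · rintro ⟨hw, hlt⟩
        refine ⟨fun i => ?_, ?_⟩
        · simpa using hw (e.symm i)
        · rwa [he0, heL] at hlt
      · rintro ⟨hw, hlt⟩
        refine ⟨fun i => hw (e i), ?_⟩
        rwa [he0, heL]
    · intro w hw
      have hw' : (fun i => w (e i)) ∈ P.domain := hw
      have h1 : P'.integrand w = P.integrand (fun i => w (e i)) := rfl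
      have h2 : P.integrand (fun i => w (e i)) =
          K (σ (w (e (Fin.last (MZV.weight s + 1)))) (Fin.tail (Fin.init fun i => w (e i)))) / (1 - w (e 0)) :=
        hintP hw'
      rw [h1, h2, he0, heL, htail w]
  -- the shuffle side `A'` (simplicial) and `A` (cubical)
  obtain ⟨⟨rA', hrA'⟩, hcells⟩ := stub_shuffleCells s hs hne Z hZ
  have hA' : KZ.of rA' - _ ∈ KZ.relations := hcells rA' hrA'
  have hT := stub_cubicalTransport s hs hne f hf
  obtain ⟨rA, hrA⟩ := hT.2.2.2 ⟨rA', hrA'⟩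
  have hAA' : KZ.of rA - KZ.of rA' ∈ KZ.relations := hT.2.2.1 rA rA' hrA hrA'
  have hP'A : KZ.of P' - KZ.of rA ∈ KZ.relations := hdescA rA P' hrA hP'shape
  have hwords := stub_shuffleWords s hs Z
  -- bookkeeping
  rw [hoffmanElement_eq]
  set RA := ((List.range s.length).map fun i => Z (raise s i)).sum with hRA
  set SP := ((List.range s.length).map fun i =>
    ((List.range (s.getD i 0 - 1)).map fun j => Z (split s i j)).sum).sum with hSP
  set INS := ((List.range s.length).map fun i => Z (s.take (i + 1) ++ [1] ++ s.drop (i + 1))).sum with hINS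
  set GAP := ((List.range (MZV.weight s)).map fun g =>
    Z (MZV.ofBinaryWord ((MZV.binaryWord s).insertIdx (g + 1) true))).sum with hGAP
  set CS := ((List.range s.length).map fun i =>
    C (s.take i ++ [s.getD i 0 + 1] ++ s.drop (i + 1)) + C (s.take (i + 1) ++ [1] ++ s.drop (i + 1))).sum with hCS
  have hGAP' : GAP = SP + INS := hwords
  have hCS' : CS - (RA + INS) ∈ KZ.relations := by
    rw [hCS, hRA, hINS, ← list_sum_map_add]
    have : ((List.range s.length).map fun i =>
        C (s.take i ++ [s.getD i 0 + 1] ++ s.drop (i + 1)) + C (s.take (i + 1) ++ [1] ++ s.drop (i + 1))).sum -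
        ((List.range s.length).map fun i => Z (raise s i) + Z (s.take (i + 1) ++ [1] ++ s.drop (i + 1))).sum =
        ((List.range s.length).map fun i =>
          (C (s.take i ++ [s.getD i 0 + 1] ++ s.drop (i + 1)) - Z (raise s i)) +
          (C (s.take (i + 1) ++ [1] ++ s.drop (i + 1)) - Z (s.take (i + 1) ++ [1] ++ s.drop (i + 1)))).sum := by
      induction (List.range s.length) with
      | nil => simp
      | cons a l ih => simp only [List.map_cons, List.sum_cons] at ih ⊢; rw [← ih]; abel
    rw [this]
    refine list_sum_mem_relations _ _ fun i _ => KZ.relations.add_mem ?_ ?_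
    · exact hCZ _ (isAdmissible_raise hs (by simpa using ‹i ∈ List.range s.length›)) (raise_ne_nil s i)
    · exact hCZ _ (isAdmissible_insertOne hs hne i).1 (isAdmissible_insertOne hs hne i).2
  -- RA - SP = (RA + INS) - GAP, and the chain B ≡ P ≡ P' ≡ A ≡ A' ≡ GAP, B ≡ CS ≡ RA + INS
  have key : RA - SP = ((RA + INS) - CS) + (CS - KZ.of rB + (KZ.of rB - KZ.of P)) +
      ((KZ.of P - KZ.of P') + (KZ.of P' - KZ.of rA)) + ((KZ.of rA - KZ.of rA') + (KZ.of rA' - GAP)) +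
      (GAP - (SP + INS)) := by abel
  rw [key]
  refine KZ.relations.add_mem (KZ.relations.add_mem (KZ.relations.add_mem (KZ.relations.add_mem ?_
    (KZ.relations.add_mem ?_ ?_)) (KZ.relations.add_mem hPP' hP'A)) (KZ.relations.add_mem hAA' hA')) ?_
  · simpa using KZ.relations.neg_mem hCS'
  · simpa using KZ.relations.neg_mem hB
  · simpa using KZ.relations.neg_mem hPB
  · rw [hGAP', sub_self]; exact KZ.relations.zero_mem

end Summit.KontsevichZagierPeriods.FurushoPentagon.HoffmanRelationInKZ
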